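import Mathlib
import Literature.MathematicalPhysics.QuantumLattice.LocalPairOn
import Literature.MathematicalPhysics.QuantumLattice.PairCorrelationsProofs
import HarnessLib

/-!
# Bond-pair modes of the nearest-neighbour singlet bonds on the torus `(ℤ/Lℤ)²`

For a side `L ≥ 1` let `B_x(e_i) = singletBond L x (Pi.single i 1) = c_{x↑}c_{x+eᵢ,↓} - c_{x↓}c_{x+eᵢ,↑}`
(`i = 0, 1`) be the nearest-neighbour singlet bond pair annihilators of
`Literature.MathematicalPhysics.QuantumLattice.LocalPairOn`, and for a MODE `φ : (ℤ/Lℤ)² → Fin 2 → ℂ`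
let `B(φ) = Σ_x Σ_i φ x i • B_x(e_i)` be the bond-pair mode operator (written out verbatim below; no
definition is introduced). `‖B(φ)ψ‖² = φ† M_ψ φ` for the Gram matrix
`M_ψ((x,i),(y,j)) = ⟨B_x(e_i)ψ, B_y(e_j)ψ⟩`, the nearest-neighbour singlet block of Yang's `ρ₂`, so
`sup_{‖φ‖=1} ‖B(φ)ψ‖²` is the Penrose–Onsager / Yang ODLRO order parameter of that block. This file
relates the modes to the zero-momentum horizontal / vertical bond pair fields
`P_h = pairField ((extendedSWave + dWaveFormFactor)/2) L`, `P_v = pairField ((extendedSWave - dWaveFormFactor)/2) L`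
of `PairCorrelations` (all sides `L ≥ 1`, no parity hypothesis):

* `BondMode.pairField_bondH_eq`, `BondMode.pairField_bondV_eq`: `P_h = √2 • Σ_x B_x(e₁)`,
  `P_v = √2 • Σ_x B_x(e₂)` (the form factor `(s' ± d)/2` is the indicator of `{±e₁}` resp. `{±e₂}`,
  and the backward bond `B_x(-e) = B_{x-e}(e)` — `singletBond_neg`, CAR — is re-indexed by the
  translation `x ↦ x - e`); equivalently `Σ_x B_x(e_i) = (1/√2) • P_i`;
* UNIFORM (zero-momentum) MODES `u_i = fun _ => Pi.single i L⁻¹`: normalised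
  (`BondMode.uniformMode_norm_sq`), `B(u_i) = (L⁻¹/√2) • P_i`, hence
  `‖B(u_h)ψ‖² = ‖P_hψ‖²/(2L²)`, `‖B(u_v)ψ‖² = ‖P_vψ‖²/(2L²)` (`BondMode.uniformMode_zero/one_norm_sq`):
  the trace of the zero-momentum `2 × 2` block of `M_ψ` is `(‖P_hψ‖² + ‖P_vψ‖²)/(2L²)`;
* ZERO-MOMENTUM DOMINANCE (`BondMode.zeroMomentumMode_norm_sq_le`): for every zero-momentum mode
  `φ = fun _ j => w j • L⁻¹` with `Σ_j ‖w j‖² = 1`, `‖B(φ)ψ‖² ≤ (‖P_hψ‖² + ‖P_vψ‖²)/(2L²)`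
  (`λ_max ≤ tr` for the PSD `2 × 2` block — Cauchy–Schwarz);
* CEILING (`BondMode.norm_sq_le`): `‖B(φ)ψ‖² ≤ 8 L² ‖ψ‖²` for every normalised mode (each bond
  operator has norm `≤ 2`, and `(Σ|φ|)² ≤ 2L² Σ|φ|²`), so `L²` is the maximal (= ODLRO) scaling of a
  bond-pair mode occupation;
* NECESSITY ALGEBRA (`BondMode.exists_mode_of_le_bondPairField`): if `a ≤ (‖P_hψ‖² + ‖P_vψ‖²)/L⁴`
  then some normalised mode (a uniform one) has `(a/4) L² ≤ ‖B(φ)ψ‖²` — a zero-momentum bond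
  condensate of density `a` is a bond-pair mode occupation `≥ (a/4)L²`.

Sources: D. J. Scalapino, Phys. Rep. 250 (1995) 329, §2, eq. (2.2)–(2.4) (singlet bond pair fields,
form factors); C. N. Yang, Rev. Mod. Phys. 34 (1962) 694, §4 (pair modes, largest eigenvalue of `ρ₂`);
O. Penrose, L. Onsager, Phys. Rev. 104 (1956) 576 (condensation = macroscopic eigenvalue). Everything
proved here is elementary bookkeeping and Cauchy–Schwarz (folklore). Deliberately NOT here: the
momentum decomposition `M_ψ = ⊕_k M_ψ(k)` for translation-covariant `ψ` (see `PairFieldMomentum`).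
-/

noncomputable section

namespace Literature.MathematicalPhysics.QuantumLattice

namespace BondMode

open Matrix Finset Literature.Probability.LatticeModels
open scoped ComplexOrder

/-! ### Preliminaries on `ℤ²` steps and the torus -/

/-- `0` is not a unit step of `ℤ²`. [folklore] -/
theorem zero_notMem_unitSteps : (0 : Site 2) ∉ unitSteps := by
  simp only [unitSteps, mem_insert, mem_singleton]
  decide

/-- `e_i ≠ -e_i` in `ℤ²`. [folklore] -/
theorem single_ne_neg_single (i : Fin 2) : (Pi.single i 1 : Site 2) ≠ -Pi.single i 1 := by
  intro h
  have h' := congrFun h i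
  simp at h'

/-- The two-element step set `{e_i, -e_i}` lies in the step set `{0} ∪ unitSteps` of `localPair`.
[folklore] -/
theorem pair_subset_insert_zero_unitSteps (i : Fin 2) :
    ({Pi.single i 1, -Pi.single i 1} : Finset (Site 2)) ⊆ insert 0 unitSteps := by
  fin_cases i <;> simp [unitSteps, Finset.insert_subset_iff]

/-- The torus `(ℤ/Lℤ)²` has `L²` sites. [folklore] -/
theorem card_torusSite_two (L : ℕ) [NeZero L] : Fintype.card (TorusSite 2 L) = L ^ 2 := by
  simp [Fintype.card_pi, ZMod.card]

/-- `(1/√2) · 2 = √2` in `ℂ`. [folklore] -/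
theorem inv_sqrt_two_mul_two : ((1 / Real.sqrt 2 : ℝ) : ℂ) * 2 = (Real.sqrt 2 : ℂ) := by
  have h : Real.sqrt 2 * Real.sqrt 2 = 2 := Real.mul_self_sqrt (by norm_num)
  have h2 : (Real.sqrt 2 : ℝ) ≠ 0 := by positivity
  have : (1 / Real.sqrt 2 : ℝ) * 2 = Real.sqrt 2 := by
    field_simp
    linarith
  exact_mod_cast this

/-- `(1/√2) · √2 = 1` in `ℂ`. [folklore] -/
theorem inv_sqrt_two_mul_sqrt_two : ((1 / Real.sqrt 2 : ℝ) : ℂ) * (Real.sqrt 2 : ℂ) = 1 := by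
  have h2 : (Real.sqrt 2 : ℝ) ≠ 0 := by positivity
  exact_mod_cast one_div_mul_cancel h2

/-! ### The bond form factors `(s' ± d)/2` are the indicators of `{±e₁}`, `{±e₂}` -/

/-- On `{0} ∪ unitSteps`, the horizontal bond form factor `(s' + d)/2` vanishes off `{±e₁}`.
Scalapino, Phys. Rep. 250 (1995) 329, §2. [folklore] -/
theorem bondH_eq_zero_of_notMem {e : Site 2} (he : e ∈ insert (0 : Site 2) unitSteps)
    (hne : e ∉ ({Pi.single 0 1, -Pi.single 0 1} : Finset (Site 2))) :
    (extendedSWave e + dWaveFormFactor e) / 2 = 0 := by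
  simp only [Finset.mem_insert, Finset.mem_singleton, not_or] at hne
  rcases Finset.mem_insert.1 he with rfl | he'
  · have hs : extendedSWave 0 = 0 := if_neg zero_notMem_unitSteps
    simp [hs]
  · have hs : extendedSWave e = 1 := if_pos he'
    have hd : dWaveFormFactor e = -1 := by
      unfold dWaveFormFactor
      rw [if_neg (not_or.2 ⟨hne.1, hne.2⟩), if_pos]
      simp only [unitSteps, Finset.mem_insert, Finset.mem_singleton] at he'
      tauto
    rw [hs, hd]; norm_num

/-- On `{0} ∪ unitSteps`, the vertical bond form factor `(s' - d)/2` vanishes off `{±e₂}`.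
Scalapino, Phys. Rep. 250 (1995) 329, §2. [folklore] -/
theorem bondV_eq_zero_of_notMem {e : Site 2} (he : e ∈ insert (0 : Site 2) unitSteps)
    (hne : e ∉ ({Pi.single 1 1, -Pi.single 1 1} : Finset (Site 2))) :
    (extendedSWave e - dWaveFormFactor e) / 2 = 0 := by
  simp only [Finset.mem_insert, Finset.mem_singleton, not_or] at hne
  rcases Finset.mem_insert.1 he with rfl | he'
  · have hs : extendedSWave 0 = 0 := if_neg zero_notMem_unitSteps
    simp [hs]
  · have hs : extendedSWave e = 1 := if_pos he'
    have hd : dWaveFormFactor e = 1 := by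
      unfold dWaveFormFactor
      rw [if_pos]
      simp only [unitSteps, Finset.mem_insert, Finset.mem_singleton] at he'
      tauto
    rw [hs, hd]; norm_num

/-- The horizontal bond form factor is `1` on `±e₁`. Scalapino (1995) §2. [folklore] -/
theorem bondH_eq_one_of_mem {e : Site 2} (he : e ∈ ({Pi.single 0 1, -Pi.single 0 1} : Finset (Site 2))) :
    (extendedSWave e + dWaveFormFactor e) / 2 = 1 := by
  simp only [Finset.mem_insert, Finset.mem_singleton] at he
  have hu : e ∈ unitSteps := by
    rcases he with rfl | rfl <;> simp [unitSteps]
  have hs : extendedSWave e = 1 := if_pos hu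
  have hd : dWaveFormFactor e = 1 := by
    unfold dWaveFormFactor
    rw [if_pos he]
  rw [hs, hd]; norm_num

/-- The vertical bond form factor is `1` on `±e₂`. Scalapino (1995) §2. [folklore] -/
theorem bondV_eq_one_of_mem {e : Site 2} (he : e ∈ ({Pi.single 1 1, -Pi.single 1 1} : Finset (Site 2))) :
    (extendedSWave e - dWaveFormFactor e) / 2 = 1 := by
  simp only [Finset.mem_insert, Finset.mem_singleton] at he
  have hu : e ∈ unitSteps := by
    rcases he with rfl | rfl <;> simp [unitSteps]
  have hs : extendedSWave e = 1 := if_pos hu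
  have hne : ¬ (e = Pi.single 0 1 ∨ e = -Pi.single 0 1) := by
    rcases he with rfl | rfl
    · rintro (h | h)
      · have := congrFun h 0; simp at this
      · have := congrFun h 0; simp at this
    · rintro (h | h)
      · have := congrFun h 1; simp at this
      · have := congrFun h 1; simp at this
  have hd : dWaveFormFactor e = -1 := by
    unfold dWaveFormFactor
    rw [if_neg hne, if_pos he]
  rw [hs, hd]; norm_num

/-! ### The bond pair fields as translation sums of singlet bonds -/

section BondSums

variable (L : ℕ) [NeZero L]

/-- A local pair whose form factor is the indicator of `{e_i, -e_i}` (on `{0} ∪ unitSteps`) is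
`(1/√2) • (B_x(e_i) + B_x(-e_i))`. Scalapino, Phys. Rep. 250 (1995) 329, §2, eq. (2.2)–(2.3). [folklore] -/
theorem localPair_eq_of_indicator (g : Site 2 → ℝ) (i : Fin 2)
    (h0 : ∀ e ∈ insert (0 : Site 2) unitSteps,
      e ∉ ({Pi.single i 1, -Pi.single i 1} : Finset (Site 2)) → g e = 0)
    (h1 : ∀ e ∈ ({Pi.single i 1, -Pi.single i 1} : Finset (Site 2)), g e = 1) (x : TorusSite 2 L) :
    localPair g L x = ((1 / Real.sqrt 2 : ℝ) : ℂ) •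
      (singletBond L x (Pi.single i 1) + singletBond L x (-Pi.single i 1)) := by
  rw [← localPairOn_insert_zero_unitSteps, localPairOn_eq_sum_singletBond,
    ← Finset.sum_subset (pair_subset_insert_zero_unitSteps i)
      (fun e he hne => by rw [h0 e he hne]; simp)]
  have hnot : (Pi.single i 1 : Site 2) ∉ ({-Pi.single i 1} : Finset (Site 2)) := by
    simpa using single_ne_neg_single i
  rw [Finset.sum_insert hnot, Finset.sum_singleton, h1 _ (by simp), h1 _ (by simp), smul_add]

/-- Backward bonds re-indexed: `Σ_x B_x(-e) = Σ_x B_x(e)` (bond reversal `B_x(-e) = B_{x-e}(e)` and the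
translation `x ↦ x - e` of the torus). Scalapino, Phys. Rep. 250 (1995) 329, §2. [folklore] -/
theorem sum_singletBond_neg (e : Site 2) :
    ∑ x : TorusSite 2 L, singletBond L x (-e) = ∑ x : TorusSite 2 L, singletBond L x e := by
  simp only [singletBond_neg]
  exact Fintype.sum_equiv (Equiv.subRight (Torus.proj L e)) _ _ fun x => rfl

/-- A pair field whose form factor is the indicator of `{±e_i}` is `√2` times the translation sum of
the singlet bonds in direction `e_i`: `Δ_g = √2 • Σ_x B_x(e_i)`. Scalapino (1995) §2. [folklore] -/
theorem pairField_eq_of_indicator (g : Site 2 → ℝ) (i : Fin 2)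
    (h0 : ∀ e ∈ insert (0 : Site 2) unitSteps,
      e ∉ ({Pi.single i 1, -Pi.single i 1} : Finset (Site 2)) → g e = 0)
    (h1 : ∀ e ∈ ({Pi.single i 1, -Pi.single i 1} : Finset (Site 2)), g e = 1) :
    pairField g L = (Real.sqrt 2 : ℂ) • ∑ x : TorusSite 2 L, singletBond L x (Pi.single i 1) := by
  unfold pairField
  simp only [localPair_eq_of_indicator L g i h0 h1, ← Finset.smul_sum, Finset.sum_add_distrib,
    sum_singletBond_neg, ← two_smul ℂ, smul_smul, inv_sqrt_two_mul_two]

/-- **`P_h = √2 • Σ_x B_x(e₁)`**: the horizontal bond pair field is `√2` times the translation sum of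
the horizontal singlet bonds. Scalapino, Phys. Rep. 250 (1995) 329, §2, eq. (2.2)–(2.3).
[cite: Scalapino1995, §2 eq. (2.2)–(2.3)] -/
theorem pairField_bondH_eq :
    pairField (fun e => (extendedSWave e + dWaveFormFactor e) / 2) L =
      (Real.sqrt 2 : ℂ) • ∑ x : TorusSite 2 L, singletBond L x (Pi.single 0 1) :=
  pairField_eq_of_indicator L _ 0 (fun _ he hne => bondH_eq_zero_of_notMem he hne)
    fun _ he => bondH_eq_one_of_mem he

/-- **`P_v = √2 • Σ_x B_x(e₂)`**: the vertical bond pair field is `√2` times the translation sum of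
the vertical singlet bonds. Scalapino, Phys. Rep. 250 (1995) 329, §2, eq. (2.2)–(2.3).
[cite: Scalapino1995, §2 eq. (2.2)–(2.3)] -/
theorem pairField_bondV_eq :
    pairField (fun e => (extendedSWave e - dWaveFormFactor e) / 2) L =
      (Real.sqrt 2 : ℂ) • ∑ x : TorusSite 2 L, singletBond L x (Pi.single 1 1) :=
  pairField_eq_of_indicator L _ 1 (fun _ he hne => bondV_eq_zero_of_notMem he hne)
    fun _ he => bondV_eq_one_of_mem he

/-- `Σ_x B_x(e₁) = (1/√2) • P_h`. Scalapino, Phys. Rep. 250 (1995) 329, §2. [folklore] -/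
theorem sum_singletBond_single_zero :
    ∑ x : TorusSite 2 L, singletBond L x (Pi.single 0 1) =
      ((1 / Real.sqrt 2 : ℝ) : ℂ) • pairField (fun e => (extendedSWave e + dWaveFormFactor e) / 2) L := by
  rw [pairField_bondH_eq, smul_smul, inv_sqrt_two_mul_sqrt_two, one_smul]

/-- `Σ_x B_x(e₂) = (1/√2) • P_v`. Scalapino, Phys. Rep. 250 (1995) 329, §2. [folklore] -/
theorem sum_singletBond_single_one :
    ∑ x : TorusSite 2 L, singletBond L x (Pi.single 1 1) =
      ((1 / Real.sqrt 2 : ℝ) : ℂ) • pairField (fun e => (extendedSWave e - dWaveFormFactor e) / 2) L := by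
  rw [pairField_bondV_eq, smul_smul, inv_sqrt_two_mul_sqrt_two, one_smul]

end BondSums

/-! ### Norm bookkeeping in the `dotProduct` language -/

section Norms

/-- Scaling an operator scales the squared norm of its image vector by `‖c‖²`:
`⟨(c•A)ψ, (c•A)ψ⟩ = ‖c‖² ⟨Aψ, Aψ⟩`. [folklore] -/
theorem star_smul_mulVec_dotProduct {n : Type*} [Fintype n] (c : ℂ) (A : Matrix n n ℂ) (ψ : n → ℂ) :
    star ((c • A) *ᵥ ψ) ⬝ᵥ ((c • A) *ᵥ ψ) = ((‖c‖ ^ 2 : ℝ) : ℂ) * (star (A *ᵥ ψ) ⬝ᵥ (A *ᵥ ψ)) := by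
  rw [Matrix.smul_mulVec, star_smul, smul_dotProduct, dotProduct_smul, smul_smul, smul_eq_mul,
    Complex.star_def, Complex.conj_mul', Complex.ofReal_pow]

/-- `re ⟨v, v⟩ = ‖v‖²_{ℓ²}` is the square of the `ℓ²` norm (restating `norm_toLp_sq_eq_re`). [folklore] -/
theorem re_star_dotProduct_self_eq_norm_sq {n : Type*} [Fintype n] (v : n → ℂ) :
    (star v ⬝ᵥ v).re = ‖(WithLp.toLp 2 v : EuclideanSpace ℂ n)‖ ^ 2 :=
  (norm_toLp_sq_eq_re v).symm

variable (L : ℕ) [NeZero L]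

omit [NeZero L] in
/-- `‖L⁻¹/√2‖² = 1/(2L²)`. [folklore] -/
theorem norm_inv_mul_inv_sqrt_two_sq :
    ‖((L : ℂ)⁻¹ * ((1 / Real.sqrt 2 : ℝ) : ℂ))‖ ^ 2 = 1 / (2 * (L : ℝ) ^ 2) := by
  rw [norm_mul, mul_pow, norm_inv, inv_pow, Complex.norm_natCast, Complex.norm_real,
    Real.norm_eq_abs, abs_of_nonneg (by positivity), div_pow, one_pow,
    Real.sq_sqrt (by norm_num : (0 : ℝ) ≤ 2)]
  field_simp

/-- Each singlet bond operator is bounded by `2`: `‖B_x(e)ψ‖ ≤ 2‖ψ‖` (two products of two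
contractions, `norm_toLp_annihilation_mulVec_le`). Bratteli–Robinson II §5.2.2. [folklore] -/
theorem norm_toLp_singletBond_mulVec_le (x : TorusSite 2 L) (e : Site 2)
    (ψ : Fock (Orb (FermionTorus 2 L))) :
    ‖(WithLp.toLp 2 (singletBond L x e *ᵥ ψ) : EuclideanSpace ℂ (Finset (Orb (FermionTorus 2 L))))‖ ≤
      2 * ‖(WithLp.toLp 2 ψ : EuclideanSpace ℂ (Finset (Orb (FermionTorus 2 L))))‖ := by
  unfold singletBond
  rw [Matrix.sub_mulVec, ← Matrix.mulVec_mulVec, ← Matrix.mulVec_mulVec, WithLp.toLp_sub, two_mul]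
  refine (norm_sub_le _ _).trans (add_le_add ?_ ?_)
  · exact (norm_toLp_annihilation_mulVec_le _ _).trans (norm_toLp_annihilation_mulVec_le _ _)
  · exact (norm_toLp_annihilation_mulVec_le _ _).trans (norm_toLp_annihilation_mulVec_le _ _)

end Norms

/-! ### The uniform (zero-momentum) bond modes -/

section UniformModes

variable (L : ℕ) [NeZero L]

/-- The uniform mode `u_i = fun _ => Pi.single i L⁻¹` is normalised: `Σ_x Σ_j ‖u_i x j‖² = 1`
(`L²` sites, each carrying weight `L⁻²` in direction `i`). [folklore] -/
theorem uniformMode_norm_sq (i : Fin 2) :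
    ∑ _x : TorusSite 2 L, ∑ j : Fin 2, ‖(Pi.single i ((L : ℂ)⁻¹) : Fin 2 → ℂ) j‖ ^ 2 = 1 := by
  have hL : (L : ℝ) ≠ 0 := Nat.cast_ne_zero.2 (NeZero.ne L)
  have hinner : ∑ j : Fin 2, ‖(Pi.single i ((L : ℂ)⁻¹) : Fin 2 → ℂ) j‖ ^ 2 = ((L : ℝ) ^ 2)⁻¹ := by
    rw [Finset.sum_eq_single i (fun j _ hj => by simp [hj]) (by simp)]
    simp [norm_inv, inv_pow]
  rw [hinner, Finset.sum_const, Finset.card_univ, card_torusSite_two, nsmul_eq_mul]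
  push_cast
  exact mul_inv_cancel₀ (pow_ne_zero 2 hL)

/-- A zero-momentum mode `φ = fun _ j => w j • L⁻¹` has `Σ_x Σ_j ‖φ x j‖² = Σ_j ‖w j‖²`. [folklore] -/
theorem zeroMomentumMode_norm_sq (w : Fin 2 → ℂ) :
    ∑ _x : TorusSite 2 L, ∑ j : Fin 2, ‖w j * (L : ℂ)⁻¹‖ ^ 2 = ∑ j : Fin 2, ‖w j‖ ^ 2 := by
  have hL : (L : ℝ) ≠ 0 := Nat.cast_ne_zero.2 (NeZero.ne L)
  simp only [norm_mul, mul_pow, norm_inv, Complex.norm_natCast, ← Finset.sum_mul]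
  rw [Finset.sum_const, Finset.card_univ, card_torusSite_two, nsmul_eq_mul]
  push_cast
  field_simp

/-- The mode operator of a zero-momentum mode is `L⁻¹ • Σ_j w j • Σ_x B_x(e_j)`. [folklore] -/
theorem bondModeOp_zeroMomentumMode (w : Fin 2 → ℂ) :
    (∑ x : TorusSite 2 L, ∑ j : Fin 2, (w j * (L : ℂ)⁻¹) • singletBond L x (Pi.single j 1)) =
      ((w 0 * (L : ℂ)⁻¹ * ((1 / Real.sqrt 2 : ℝ) : ℂ)) •
          pairField (fun e => (extendedSWave e + dWaveFormFactor e) / 2) L +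
        (w 1 * (L : ℂ)⁻¹ * ((1 / Real.sqrt 2 : ℝ) : ℂ)) •
          pairField (fun e => (extendedSWave e - dWaveFormFactor e) / 2) L) := by
  rw [Finset.sum_comm]
  simp only [← Finset.smul_sum, Fin.sum_univ_two, sum_singletBond_single_zero,
    sum_singletBond_single_one, smul_smul]

/-- The mode operator of the uniform mode in direction `i` is `L⁻¹ • Σ_x B_x(e_i)`. [folklore] -/
theorem bondModeOp_uniformMode (i : Fin 2) :
    (∑ x : TorusSite 2 L, ∑ j : Fin 2,
        (Pi.single i ((L : ℂ)⁻¹) : Fin 2 → ℂ) j • singletBond L x (Pi.single j 1)) =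
      ((L : ℂ)⁻¹) • ∑ x : TorusSite 2 L, singletBond L x (Pi.single i 1) := by
  rw [Finset.smul_sum]
  refine Finset.sum_congr rfl fun x _ => ?_
  rw [Finset.sum_eq_single i (fun j _ hj => by simp [hj]) (by simp)]
  simp

/-- **`B(u_h) = (L⁻¹/√2) • P_h`**: the horizontal uniform mode operator is the horizontal bond pair
field rescaled. Scalapino, Phys. Rep. 250 (1995) 329, §2. [folklore] -/
theorem bondModeOp_uniformMode_zero :
    (∑ x : TorusSite 2 L, ∑ j : Fin 2,
        (Pi.single (0 : Fin 2) ((L : ℂ)⁻¹) : Fin 2 → ℂ) j • singletBond L x (Pi.single j 1)) =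
      ((L : ℂ)⁻¹ * ((1 / Real.sqrt 2 : ℝ) : ℂ)) •
        pairField (fun e => (extendedSWave e + dWaveFormFactor e) / 2) L := by
  rw [bondModeOp_uniformMode, sum_singletBond_single_zero, smul_smul]

/-- **`B(u_v) = (L⁻¹/√2) • P_v`**: the vertical uniform mode operator is the vertical bond pair field
rescaled. Scalapino, Phys. Rep. 250 (1995) 329, §2. [folklore] -/
theorem bondModeOp_uniformMode_one :
    (∑ x : TorusSite 2 L, ∑ j : Fin 2,
        (Pi.single (1 : Fin 2) ((L : ℂ)⁻¹) : Fin 2 → ℂ) j • singletBond L x (Pi.single j 1)) =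
      ((L : ℂ)⁻¹ * ((1 / Real.sqrt 2 : ℝ) : ℂ)) •
        pairField (fun e => (extendedSWave e - dWaveFormFactor e) / 2) L := by
  rw [bondModeOp_uniformMode, sum_singletBond_single_one, smul_smul]

/-- **`‖B(u_h)ψ‖² = ‖P_hψ‖²/(2L²)`** (real parts, in the `dotProduct`/`expect` language): the
occupation of the horizontal uniform bond mode is the horizontal zero-momentum bond pair-field
density. Scalapino, Phys. Rep. 250 (1995) 329, §2, eq. (2.4); Yang, Rev. Mod. Phys. 34 (1962) 694, §4.
[cite: Yang1962, §4] -/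
theorem uniformMode_zero_norm_sq (ψ : Fock (Orb (FermionTorus 2 L))) :
    (star ((∑ x : TorusSite 2 L, ∑ j : Fin 2,
        (Pi.single (0 : Fin 2) ((L : ℂ)⁻¹) : Fin 2 → ℂ) j • singletBond L x (Pi.single j 1)) *ᵥ ψ) ⬝ᵥ
      ((∑ x : TorusSite 2 L, ∑ j : Fin 2,
        (Pi.single (0 : Fin 2) ((L : ℂ)⁻¹) : Fin 2 → ℂ) j • singletBond L x (Pi.single j 1)) *ᵥ ψ)).re =
      (expect (Matrix.conjTranspose (pairField (fun e => (extendedSWave e + dWaveFormFactor e) / 2) L) *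
          pairField (fun e => (extendedSWave e + dWaveFormFactor e) / 2) L) ψ).re / (2 * (L : ℝ) ^ 2) := by
  rw [bondModeOp_uniformMode_zero, star_smul_mulVec_dotProduct, norm_inv_mul_inv_sqrt_two_sq,
    PosSemidefTrace.expect_conjTranspose_mul, Complex.re_ofReal_mul]
  ring

/-- **`‖B(u_v)ψ‖² = ‖P_vψ‖²/(2L²)`**. Scalapino (1995) §2, eq. (2.4); Yang (1962) §4. [cite: Yang1962, §4] -/
theorem uniformMode_one_norm_sq (ψ : Fock (Orb (FermionTorus 2 L))) :
    (star ((∑ x : TorusSite 2 L, ∑ j : Fin 2,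
        (Pi.single (1 : Fin 2) ((L : ℂ)⁻¹) : Fin 2 → ℂ) j • singletBond L x (Pi.single j 1)) *ᵥ ψ) ⬝ᵥ
      ((∑ x : TorusSite 2 L, ∑ j : Fin 2,
        (Pi.single (1 : Fin 2) ((L : ℂ)⁻¹) : Fin 2 → ℂ) j • singletBond L x (Pi.single j 1)) *ᵥ ψ)).re =
      (expect (Matrix.conjTranspose (pairField (fun e => (extendedSWave e - dWaveFormFactor e) / 2) L) *
          pairField (fun e => (extendedSWave e - dWaveFormFactor e) / 2) L) ψ).re / (2 * (L : ℝ) ^ 2) := by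
  rw [bondModeOp_uniformMode_one, star_smul_mulVec_dotProduct, norm_inv_mul_inv_sqrt_two_sq,
    PosSemidefTrace.expect_conjTranspose_mul, Complex.re_ofReal_mul]
  ring

end UniformModes

/-! ### Zero-momentum dominance: `λ_max ≤ tr` on the zero-momentum `2 × 2` block -/

section ZeroMomentum

variable (L : ℕ) [NeZero L]

/-- Cauchy–Schwarz for two terms: `(a₀b₀ + a₁b₁)² ≤ (a₀² + a₁²)(b₀² + b₁²)`. [folklore] -/
theorem sq_add_mul_le (a₀ a₁ b₀ b₁ : ℝ) :
    (a₀ * b₀ + a₁ * b₁) ^ 2 ≤ (a₀ ^ 2 + a₁ ^ 2) * (b₀ ^ 2 + b₁ ^ 2) := by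
  nlinarith [sq_nonneg (a₀ * b₁ - a₁ * b₀)]

/-- **Zero-momentum dominance.** For every zero-momentum bond mode `φ = fun _ j => w j • L⁻¹` with
`Σ_j ‖w j‖² = 1` (any complex mixture of the horizontal and vertical uniform modes) and every Fock
vector `ψ`: `‖B(φ)ψ‖² ≤ (‖P_hψ‖² + ‖P_vψ‖²)/(2L²)` — the top eigenvalue of the (PSD) zero-momentum
`2 × 2` block of the bond-pair Gram matrix is at most its trace. Yang, Rev. Mod. Phys. 34 (1962) 694,
§4 (largest eigenvalue of a reduced density matrix block); elementary (Cauchy–Schwarz). [folklore] -/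
theorem zeroMomentumMode_norm_sq_le (w : Fin 2 → ℂ) (hw : ∑ j : Fin 2, ‖w j‖ ^ 2 = 1)
    (ψ : Fock (Orb (FermionTorus 2 L))) :
    (star ((∑ x : TorusSite 2 L, ∑ j : Fin 2, (w j * (L : ℂ)⁻¹) • singletBond L x (Pi.single j 1)) *ᵥ ψ) ⬝ᵥ
      ((∑ x : TorusSite 2 L, ∑ j : Fin 2, (w j * (L : ℂ)⁻¹) • singletBond L x (Pi.single j 1)) *ᵥ ψ)).re ≤
      ((expect (Matrix.conjTranspose (pairField (fun e => (extendedSWave e + dWaveFormFactor e) / 2) L) *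
            pairField (fun e => (extendedSWave e + dWaveFormFactor e) / 2) L) ψ).re +
        (expect (Matrix.conjTranspose (pairField (fun e => (extendedSWave e - dWaveFormFactor e) / 2) L) *
            pairField (fun e => (extendedSWave e - dWaveFormFactor e) / 2) L) ψ).re) /
        (2 * (L : ℝ) ^ 2) := by
  -- abbreviations: the two pair-field vectors and the two scalar coefficients
  set Ph := pairField (fun e => (extendedSWave e + dWaveFormFactor e) / 2) L with hPh
  set Pv := pairField (fun e => (extendedSWave e - dWaveFormFactor e) / 2) L with hPv
  set c₀ : ℂ := w 0 * (L : ℂ)⁻¹ * ((1 / Real.sqrt 2 : ℝ) : ℂ) with hc₀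
  set c₁ : ℂ := w 1 * (L : ℂ)⁻¹ * ((1 / Real.sqrt 2 : ℝ) : ℂ) with hc₁
  have hop := bondModeOp_zeroMomentumMode L w
  rw [hop, PosSemidefTrace.expect_conjTranspose_mul, PosSemidefTrace.expect_conjTranspose_mul,
    re_star_dotProduct_self_eq_norm_sq, re_star_dotProduct_self_eq_norm_sq,
    re_star_dotProduct_self_eq_norm_sq, Matrix.add_mulVec, Matrix.smul_mulVec, Matrix.smul_mulVec,
    WithLp.toLp_add, WithLp.toLp_smul, WithLp.toLp_smul]
  set vh : EuclideanSpace ℂ (Finset (Orb (FermionTorus 2 L))) := WithLp.toLp 2 (Ph *ᵥ ψ) with hvh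
  set vv : EuclideanSpace ℂ (Finset (Orb (FermionTorus 2 L))) := WithLp.toLp 2 (Pv *ᵥ ψ) with hvv
  -- the coefficients: ‖c₀‖² + ‖c₁‖² = 1/(2L²)
  have hL : (0 : ℝ) < (L : ℝ) := Nat.cast_pos.2 (Nat.pos_of_ne_zero (NeZero.ne L))
  have hcoef : ‖c₀‖ ^ 2 + ‖c₁‖ ^ 2 = 1 / (2 * (L : ℝ) ^ 2) := by
    have h2 : ‖((L : ℂ)⁻¹ * ((1 / Real.sqrt 2 : ℝ) : ℂ))‖ ^ 2 = 1 / (2 * (L : ℝ) ^ 2) :=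
      norm_inv_mul_inv_sqrt_two_sq L
    have e0 : c₀ = w 0 * ((L : ℂ)⁻¹ * ((1 / Real.sqrt 2 : ℝ) : ℂ)) := by rw [hc₀, mul_assoc]
    have e1 : c₁ = w 1 * ((L : ℂ)⁻¹ * ((1 / Real.sqrt 2 : ℝ) : ℂ)) := by rw [hc₁, mul_assoc]
    rw [e0, e1, norm_mul (w 0), norm_mul (w 1), mul_pow, mul_pow, h2, ← add_mul]
    have hw' : ‖w 0‖ ^ 2 + ‖w 1‖ ^ 2 = 1 := by simpa [Fin.sum_univ_two] using hw
    rw [hw', one_mul]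
  -- triangle inequality and Cauchy–Schwarz for two terms
  have htri : ‖c₀ • vh + c₁ • vv‖ ≤ ‖c₀‖ * ‖vh‖ + ‖c₁‖ * ‖vv‖ := by
    calc ‖c₀ • vh + c₁ • vv‖ ≤ ‖c₀ • vh‖ + ‖c₁ • vv‖ := norm_add_le _ _
      _ = ‖c₀‖ * ‖vh‖ + ‖c₁‖ * ‖vv‖ := by rw [norm_smul, norm_smul]
  have hcs : (‖c₀‖ * ‖vh‖ + ‖c₁‖ * ‖vv‖) ^ 2 ≤ (‖c₀‖ ^ 2 + ‖c₁‖ ^ 2) * (‖vh‖ ^ 2 + ‖vv‖ ^ 2) :=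
    sq_add_mul_le _ _ _ _
  have hsq : ‖c₀ • vh + c₁ • vv‖ ^ 2 ≤ (‖c₀‖ * ‖vh‖ + ‖c₁‖ * ‖vv‖) ^ 2 :=
    pow_le_pow_left₀ (norm_nonneg _) htri 2
  calc ‖c₀ • vh + c₁ • vv‖ ^ 2 ≤ (‖c₀‖ ^ 2 + ‖c₁‖ ^ 2) * (‖vh‖ ^ 2 + ‖vv‖ ^ 2) := hsq.trans hcs
    _ = (‖vh‖ ^ 2 + ‖vv‖ ^ 2) / (2 * (L : ℝ) ^ 2) := by rw [hcoef]; ring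

end ZeroMomentum

/-! ### The ceiling `‖B(φ)ψ‖² ≤ 8L²‖ψ‖²` -/

section Ceiling

variable (L : ℕ) [NeZero L]

/-- `(Σ_x Σ_j |φ x j|)² ≤ 2L² · Σ_x Σ_j |φ x j|²` (Cauchy–Schwarz on the `2L²` bond index set). [folklore] -/
theorem sq_sum_norm_le (φ : TorusSite 2 L → Fin 2 → ℂ) :
    (∑ x : TorusSite 2 L, ∑ j : Fin 2, ‖φ x j‖) ^ 2 ≤
      2 * (L : ℝ) ^ 2 * ∑ x : TorusSite 2 L, ∑ j : Fin 2, ‖φ x j‖ ^ 2 := by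
  have h := sq_sum_le_card_mul_sum_sq (s := (Finset.univ : Finset (TorusSite 2 L × Fin 2)))
    (f := fun p => ‖φ p.1 p.2‖)
  rw [Finset.card_univ, Fintype.card_prod, card_torusSite_two, Fintype.card_fin] at h
  simpa [Fintype.sum_prod_type, mul_comm] using h

/-- **Ceiling.** For every normalised bond mode `φ` (`Σ_x Σ_j ‖φ x j‖² = 1`) and every Fock vector `ψ`:
`‖B(φ)ψ‖² ≤ 8 L² ‖ψ‖²` — each singlet bond operator has norm `≤ 2` and `(Σ|φ|)² ≤ 2L²`. Hence `L²` is
the maximal (ODLRO) scaling of a bond-pair mode occupation. Yang, Rev. Mod. Phys. 34 (1962) 694, §4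
(bound on the largest eigenvalue of `ρ₂` for fermions); elementary. [folklore] -/
theorem norm_sq_le (φ : TorusSite 2 L → Fin 2 → ℂ)
    (hφ : ∑ x : TorusSite 2 L, ∑ j : Fin 2, ‖φ x j‖ ^ 2 = 1) (ψ : Fock (Orb (FermionTorus 2 L))) :
    (star ((∑ x : TorusSite 2 L, ∑ j : Fin 2, φ x j • singletBond L x (Pi.single j 1)) *ᵥ ψ) ⬝ᵥ
      ((∑ x : TorusSite 2 L, ∑ j : Fin 2, φ x j • singletBond L x (Pi.single j 1)) *ᵥ ψ)).re ≤
      8 * (L : ℝ) ^ 2 * (star ψ ⬝ᵥ ψ).re := by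
  rw [re_star_dotProduct_self_eq_norm_sq, re_star_dotProduct_self_eq_norm_sq]
  set nψ := ‖(WithLp.toLp 2 ψ : EuclideanSpace ℂ (Finset (Orb (FermionTorus 2 L))))‖ with hnψ
  set S := ∑ x : TorusSite 2 L, ∑ j : Fin 2, ‖φ x j‖ with hS
  -- ‖B(φ)ψ‖ ≤ 2 ‖ψ‖ S
  have hle : ‖(WithLp.toLp 2 ((∑ x : TorusSite 2 L, ∑ j : Fin 2,
      φ x j • singletBond L x (Pi.single j 1)) *ᵥ ψ) : EuclideanSpace ℂ (Finset (Orb (FermionTorus 2 L))))‖ ≤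
      2 * nψ * S := by
    simp only [Matrix.sum_mulVec, Matrix.smul_mulVec, WithLp.toLp_sum, WithLp.toLp_smul]
    rw [hS, Finset.mul_sum]
    refine (norm_sum_le _ _).trans (Finset.sum_le_sum fun x _ => ?_)
    rw [Finset.mul_sum]
    refine (norm_sum_le _ _).trans (Finset.sum_le_sum fun j _ => ?_)
    rw [norm_smul]
    calc ‖φ x j‖ * ‖(WithLp.toLp 2 (singletBond L x (Pi.single j 1) *ᵥ ψ) :
          EuclideanSpace ℂ (Finset (Orb (FermionTorus 2 L))))‖ ≤ ‖φ x j‖ * (2 * nψ) :=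
          mul_le_mul_of_nonneg_left (norm_toLp_singletBond_mulVec_le L x _ ψ) (norm_nonneg _)
      _ = 2 * nψ * ‖φ x j‖ := by ring
  have hS2 : S ^ 2 ≤ 2 * (L : ℝ) ^ 2 := by
    have h := sq_sum_norm_le L φ
    rw [hφ, mul_one] at h
    exact h
  have hnn : 0 ≤ 2 * nψ * S := by positivity
  calc ‖(WithLp.toLp 2 ((∑ x : TorusSite 2 L, ∑ j : Fin 2,
        φ x j • singletBond L x (Pi.single j 1)) *ᵥ ψ) : EuclideanSpace ℂ (Finset (Orb (FermionTorus 2 L))))‖ ^ 2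
        ≤ (2 * nψ * S) ^ 2 := pow_le_pow_left₀ (norm_nonneg _) hle 2
    _ = 4 * nψ ^ 2 * S ^ 2 := by ring
    _ ≤ 4 * nψ ^ 2 * (2 * (L : ℝ) ^ 2) := by gcongr
    _ = 8 * (L : ℝ) ^ 2 * nψ ^ 2 := by ring

end Ceiling

/-! ### Necessity algebra: a zero-momentum bond condensate occupies a uniform mode -/

section Necessity

variable (L : ℕ) [NeZero L]

/-- **Necessity algebra.** If `a ≤ (‖P_hψ‖² + ‖P_vψ‖²)/L⁴` then one of the two uniform modes is
occupied at least `(a/4)L²`: there is a normalised mode `φ` with `(a/4) L² ≤ ‖B(φ)ψ‖²`. (The larger of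
`‖P_hψ‖²`, `‖P_vψ‖²` is `≥ aL⁴/2`, and `‖B(u_i)ψ‖² = ‖P_iψ‖²/(2L²)`.) With the Hubbard hypotheses
passed through, this is "zero-momentum bond condensation ⇒ bond-mode condensation". Scalapino,
Phys. Rep. 250 (1995) 329, §2; Yang, Rev. Mod. Phys. 34 (1962) 694, §4. [folklore] -/
theorem exists_mode_of_le_bondPairField (a : ℝ) (ψ : Fock (Orb (FermionTorus 2 L)))
    (h : a ≤ ((expect (Matrix.conjTranspose (pairField (fun e => (extendedSWave e + dWaveFormFactor e) / 2) L) *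
            pairField (fun e => (extendedSWave e + dWaveFormFactor e) / 2) L) ψ).re +
        (expect (Matrix.conjTranspose (pairField (fun e => (extendedSWave e - dWaveFormFactor e) / 2) L) *
            pairField (fun e => (extendedSWave e - dWaveFormFactor e) / 2) L) ψ).re) / (L : ℝ) ^ 4) :
    ∃ φ : TorusSite 2 L → Fin 2 → ℂ, (∑ x, ∑ i, ‖φ x i‖ ^ 2 = 1) ∧
      a / 4 * (L : ℝ) ^ 2 ≤
        (star ((∑ x : TorusSite 2 L, ∑ i : Fin 2, φ x i • singletBond L x (Pi.single i 1)) *ᵥ ψ) ⬝ᵥ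
          ((∑ x : TorusSite 2 L, ∑ i : Fin 2, φ x i • singletBond L x (Pi.single i 1)) *ᵥ ψ)).re := by
  set Xh := (expect (Matrix.conjTranspose (pairField (fun e => (extendedSWave e + dWaveFormFactor e) / 2) L) *
      pairField (fun e => (extendedSWave e + dWaveFormFactor e) / 2) L) ψ).re with hXh
  set Xv := (expect (Matrix.conjTranspose (pairField (fun e => (extendedSWave e - dWaveFormFactor e) / 2) L) *
      pairField (fun e => (extendedSWave e - dWaveFormFactor e) / 2) L) ψ).re with hXv
  have hL : (0 : ℝ) < (L : ℝ) := Nat.cast_pos.2 (Nat.pos_of_ne_zero (NeZero.ne L))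
  have hL2 : (0 : ℝ) < (L : ℝ) ^ 2 := by positivity
  have hL4 : (0 : ℝ) < (L : ℝ) ^ 4 := by positivity
  have hsum : a * (L : ℝ) ^ 4 ≤ Xh + Xv := (le_div_iff₀ hL4).1 h
  have key : ∀ X : ℝ, a * (L : ℝ) ^ 4 ≤ 2 * X → a / 4 * (L : ℝ) ^ 2 ≤ X / (2 * (L : ℝ) ^ 2) := by
    intro X hX
    rw [le_div_iff₀ (by positivity)]
    have : (L : ℝ) ^ 4 = (L : ℝ) ^ 2 * (L : ℝ) ^ 2 := by ring
    nlinarith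
  rcases le_total Xv Xh with hhv | hvh
  · refine ⟨fun _ => Pi.single (0 : Fin 2) ((L : ℂ)⁻¹), uniformMode_norm_sq L 0, ?_⟩
    rw [uniformMode_zero_norm_sq]
    exact key Xh (by linarith)
  · refine ⟨fun _ => Pi.single (1 : Fin 2) ((L : ℂ)⁻¹), uniformMode_norm_sq L 1, ?_⟩
    rw [uniformMode_one_norm_sq]
    exact key Xv (by linarith)

end Necessity

end BondMode

end Literature.MathematicalPhysics.QuantumLattice

end
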